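import Summits.ResolutionOfSingularities.ResolutionOfSingularities.Theses.FrobeniusLadder
import Summits.ResolutionOfSingularities.ResolutionOfSingularities.Theorems.FrobeniusLadderFRationalModificationIsolateDefectOfHasResolution
import Summits.ResolutionOfSingularities.ResolutionOfSingularities.Theorems.FrobeniusLadderFRationalResolutionFRationalCMStalk
import Summits.ResolutionOfSingularities.ResolutionOfSingularities.Theorems.FrobeniusLadderFRationalResolutionFrobeniusClosedOfClause
import Mathlib.AlgebraicGeometry.Morphisms.Proper
import HarnessLib

/-!
# `FRationalModification` — the crux itself witnesses the open stub `stub_isolateDefect`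

Support lemma for crux `stmt-ResolutionOfSingularities-15316`
(`Summit.ResolutionOfSingularities.ResolutionOfSingularities.Theses.FrobeniusLadder.FRationalModification`,
route FrobeniusLadder), line `socle-discrepancy-certificate`, skeleton v4 (registered a75e9df0). The line's
global open stub S4° `stub_isolateDefect` says: every integral separated finite-type rung-2 `Y/k`
(`char k = p` prime; rung-2 = stalks are domains, every system of parameters is a weakly regular sequence
generating a Frobenius-closed ideal — inline) has a proper birational model `ρ : Y' → Y` with `Y'`
integral and rung-2 at every point, FINITE rung-3 defect `{x | ¬ rung-3 (𝒪_{Y',x})}` (rung-3 = domain with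
tightly closed parameter ideals — inline), and every defect point an isolated singularity.

This file records that S4° is not a REDUCTION of the crux but a COROLLARY of it:

* `rungTwo_stalk_of_rungThree` — at a stalk of a `k`-scheme locally of finite type, rung-3 implies
  rung-2: an F-rational stalk is Cohen–Macaulay (Hochster–Huneke 1994, Thm. 4.2 (c), in tree as
  `FRationalResolution.isWeaklyRegular_sop_stalk_of_fRational_clause`) and its parameter ideals, being
  tightly closed, are Frobenius closed (Fedder–Watanabe 1989, Rem. 1.9, in tree as
  `FRationalResolution.frobeniusClosed_sop_of_fRational_clause`).
* `isolateDefect_of_rungThreeModel` — hence ANY proper birational model of `Y` with rung-3 stalks (an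
  F-rational model) already satisfies the conclusion of S4°: it is integral, rung-2 everywhere, and its
  defect is empty.
* `isolateDefect_of_fRationalModification` — in particular the crux `FRationalModification`, applied to
  `Y` itself (which is its own rung-2 model along `𝟙 Y`), implies S4° verbatim. Together with the
  skeleton's composition `S4° ∧ S2' ⇒ FRationalModification` this exhibits S4° as crux-equivalent modulo
  the local stub S2', i.e. the line `socle-discrepancy-certificate` does not lower the crux.

No definition is declared; every statement is written inline in the route file's vocabulary.

## Sources
* M. Hochster, C. Huneke, *F-regularity, test elements, and smooth base change*, Trans. AMS 346 (1994),
  Thm. 4.2 (c) (F-rational ⇒ Cohen–Macaulay for homomorphic images of CM rings; in tree).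
* R. Fedder, K.-i. Watanabe, *A characterization of F-regularity in terms of F-purity* (1989), Rem. 1.9
  (tight closure contains Frobenius closure; in tree).
* The Stacks Project, Tag 01RN (birational morphisms; in tree `IsBirational`).
-/

-- single-problem summit: the doubled namespace component `ResolutionOfSingularities` is forced
set_option linter.dupNamespace false

noncomputable section

open CategoryTheory AlgebraicGeometry IsLocalRing
open Literature.AlgebraicGeometry.Resolution
open Summit.ResolutionOfSingularities.ResolutionOfSingularities.Theses.FrobeniusLadder

namespace Summit.ResolutionOfSingularities.ResolutionOfSingularities.Theorems.FRationalModification.IsolateDefectOfCrux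

/-- **Rung-3 ⇒ rung-2 at the stalks of a `k`-scheme locally of finite type** (`char k = p` prime): if the
stalk `𝒪_{Y,y}` is a domain all of whose ideals generated by a system of parameters are tightly closed
(inline clause), then every system of parameters of `𝒪_{Y,y}` is a weakly regular sequence
(Hochster–Huneke 1994, Thm. 4.2 (c)) generating a Frobenius-closed ideal (Fedder–Watanabe 1989,
Rem. 1.9). [cite: HochsterHuneke1994, Thm. 4.2 (c)] -/
theorem rungTwo_stalk_of_rungThree (p : ℕ) [Fact p.Prime] (k : Type) [Field k] [CharP k p]
    (Y : Scheme.{0}) (g : Y ⟶ Spec (.of k)) [LocallyOfFiniteType g] (y : Y)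
    (h₃ : IsDomain (Y.presheaf.stalk y) ∧ ∀ d : ℕ, ringKrullDim (Y.presheaf.stalk y) = d →
      ∀ s : Fin d → (Y.presheaf.stalk y), (Ideal.span (Set.range s)).radical.IsMaximal →
      ∀ u c : (Y.presheaf.stalk y), c ≠ 0 → (∀ e : ℕ, c * u ^ p ^ e ∈
      Ideal.span ((fun z : (Y.presheaf.stalk y) => z ^ p ^ e) ''
      (Ideal.span (Set.range s) : Set (Y.presheaf.stalk y)))) → u ∈ Ideal.span (Set.range s)) :
    IsDomain (Y.presheaf.stalk y) ∧ ∀ d : ℕ, ringKrullDim (Y.presheaf.stalk y) = d →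
      ∀ s : Fin d → (Y.presheaf.stalk y), (Ideal.span (Set.range s)).radical.IsMaximal →
      RingTheory.Sequence.IsWeaklyRegular (Y.presheaf.stalk y) (List.ofFn s) ∧
      ∀ u : (Y.presheaf.stalk y), (∃ e : ℕ, u ^ p ^ e ∈
      Ideal.span ((fun z : (Y.presheaf.stalk y) => z ^ p ^ e) ''
      (Ideal.span (Set.range s) : Set (Y.presheaf.stalk y)))) → u ∈ Ideal.span (Set.range s) := by
  have hp : p.Prime := Fact.out
  haveI := Negative.charP_stalk g y
  exact ⟨h₃.1, fun d hd s hs =>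
    ⟨FRationalResolution.isWeaklyRegular_sop_stalk_of_fRational_clause p hp k Y g y h₃ hd s hs,
      FRationalResolution.frobeniusClosed_sop_of_fRational_clause p hp h₃ d hd s hs⟩⟩

/-- **An F-rational model already isolates the defect.** Let `Y` be an integral `k`-scheme locally of
finite type (`char k = p` prime) and `ρ : Y' → Y` a proper birational morphism all of whose source stalks
are rung-3 (domains with tightly closed parameter ideals, inline). Then `ρ` satisfies the conclusion of the
line's stub S4° `stub_isolateDefect`: `Y'` is integral, rung-2 at every point
(`rungTwo_stalk_of_rungThree`), its rung-3 defect is empty — in particular finite — and the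
isolated-singularity condition on defect points is vacuous. [folklore] -/
theorem isolateDefect_of_rungThreeModel (p : ℕ) [Fact p.Prime] (k : Type) [Field k] [CharP k p]
    (Y : Scheme.{0}) (g : Y ⟶ Spec (.of k)) [LocallyOfFiniteType g] [IsIntegral Y]
    {Y' : Scheme.{0}} (ρ : Y' ⟶ Y) [IsProper ρ] (hρ : IsBirational ρ)
    (h₃ : ∀ x : Y', (IsDomain (Y'.presheaf.stalk x) ∧ ∀ d : ℕ, ringKrullDim (Y'.presheaf.stalk x) = d →
    ∀ s : Fin d → (Y'.presheaf.stalk x), (Ideal.span (Set.range s)).radical.IsMaximal →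
    ∀ u c : (Y'.presheaf.stalk x), c ≠ 0 → (∀ e : ℕ, c * u ^ p ^ e ∈
    Ideal.span ((fun z : (Y'.presheaf.stalk x) => z ^ p ^ e) ''
    (Ideal.span (Set.range s) : Set (Y'.presheaf.stalk x)))) → u ∈ Ideal.span (Set.range s))) :
    IsProper ρ ∧ IsBirational ρ ∧ IsIntegral Y' ∧ (∀ y : Y', (IsDomain (Y'.presheaf.stalk y) ∧ ∀ d : ℕ,
    ringKrullDim (Y'.presheaf.stalk y) = d → ∀ s : Fin d → (Y'.presheaf.stalk y),
    (Ideal.span (Set.range s)).radical.IsMaximal →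
    RingTheory.Sequence.IsWeaklyRegular (Y'.presheaf.stalk y) (List.ofFn s) ∧
    ∀ u : (Y'.presheaf.stalk y), (∃ e : ℕ, u ^ p ^ e ∈
    Ideal.span ((fun z : (Y'.presheaf.stalk y) => z ^ p ^ e) ''
    (Ideal.span (Set.range s) : Set (Y'.presheaf.stalk y)))) → u ∈ Ideal.span (Set.range s))) ∧
    {x : Y' | ¬ (IsDomain (Y'.presheaf.stalk x) ∧ ∀ d : ℕ, ringKrullDim (Y'.presheaf.stalk x) = d →
    ∀ s : Fin d → (Y'.presheaf.stalk x), (Ideal.span (Set.range s)).radical.IsMaximal →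
    ∀ u c : (Y'.presheaf.stalk x), c ≠ 0 → (∀ e : ℕ, c * u ^ p ^ e ∈
    Ideal.span ((fun z : (Y'.presheaf.stalk x) => z ^ p ^ e) ''
    (Ideal.span (Set.range s) : Set (Y'.presheaf.stalk x)))) → u ∈ Ideal.span (Set.range s))}.Finite ∧
    (∀ x : Y', ¬ (IsDomain (Y'.presheaf.stalk x) ∧ ∀ d : ℕ, ringKrullDim (Y'.presheaf.stalk x) = d →
    ∀ s : Fin d → (Y'.presheaf.stalk x), (Ideal.span (Set.range s)).radical.IsMaximal →
    ∀ u c : (Y'.presheaf.stalk x), c ≠ 0 → (∀ e : ℕ, c * u ^ p ^ e ∈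
    Ideal.span ((fun z : (Y'.presheaf.stalk x) => z ^ p ^ e) ''
    (Ideal.span (Set.range s) : Set (Y'.presheaf.stalk x)))) → u ∈ Ideal.span (Set.range s)) →
    ∀ y : Y', y ⤳ x → y ≠ x → IsRegularLocalRing (Y'.presheaf.stalk y)) := by
  -- `Y'` is locally of finite type over `k` along `ρ ≫ g`
  haveI : LocallyOfFiniteType (ρ ≫ g) := inferInstance
  have h2 := fun y => rungTwo_stalk_of_rungThree p k Y' (ρ ≫ g) y (h₃ y)
  refine ⟨inferInstance, hρ,
    IsolateDefectOfHasResolution.isIntegral_of_isBirational_of_isDomain_stalk hρ fun x => (h₃ x).1,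
    h2, ?_, fun x hx => absurd (h₃ x) hx⟩
  -- the rung-3 defect locus is empty
  have hempty : {x : Y' | ¬ (IsDomain (Y'.presheaf.stalk x) ∧ ∀ d : ℕ,
      ringKrullDim (Y'.presheaf.stalk x) = d → ∀ s : Fin d → (Y'.presheaf.stalk x),
      (Ideal.span (Set.range s)).radical.IsMaximal →
      ∀ u c : (Y'.presheaf.stalk x), c ≠ 0 → (∀ e : ℕ, c * u ^ p ^ e ∈
      Ideal.span ((fun z : (Y'.presheaf.stalk x) => z ^ p ^ e) ''
      (Ideal.span (Set.range s) : Set (Y'.presheaf.stalk x)))) → u ∈ Ideal.span (Set.range s))} =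
      (∅ : Set Y') :=
    Set.eq_empty_of_forall_notMem fun x hx => hx (h₃ x)
  rw [hempty]
  exact Set.finite_empty

/-- **The crux implies its own hardest stub.** `FRationalModification` implies, verbatim, the statement of
the open global stub S4° `stub_isolateDefect` of line `socle-discrepancy-certificate` (skeleton v4): an
integral separated finite-type rung-2 `Y/k` is its own rung-2 model along `𝟙 Y`, so the crux hands it a
proper birational model with rung-3 stalks, which isolates the defect by
`isolateDefect_of_rungThreeModel` (empty defect). Since the skeleton proves
`S4° ∧ S2' → FRationalModification`, the stub S4° is crux-equivalent modulo the local stub S2'.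
[folklore] -/
theorem isolateDefect_of_fRationalModification (hcrux : FRationalModification)
    (p : ℕ) [Fact p.Prime] (k : Type) [Field k] [CharP k p] (Y : Scheme.{0}) (g : Y ⟶ Spec (.of k))
    [IsSeparated g] [LocallyOfFiniteType g] [QuasiCompact g] [IsIntegral Y] (h₂ : ∀ y : Y, (IsDomain
    (Y.presheaf.stalk y) ∧ ∀ d : ℕ, ringKrullDim (Y.presheaf.stalk y) = d → ∀ s : Fin d → (Y.presheaf.stalk
    y), (Ideal.span (Set.range s)).radical.IsMaximal → RingTheory.Sequence.IsWeaklyRegular (Y.presheaf.stalk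
    y) (List.ofFn s) ∧ ∀ u : (Y.presheaf.stalk y), (∃ e : ℕ, u ^ p ^ e ∈ Ideal.span ((fun z :
    (Y.presheaf.stalk y) => z ^ p ^ e) '' (Ideal.span (Set.range s) : Set (Y.presheaf.stalk y)))) → u ∈
    Ideal.span (Set.range s))) : ∃ (Y' : Scheme.{0}) (ρ : Y' ⟶ Y), IsProper ρ ∧ IsBirational ρ ∧ IsIntegral
    Y' ∧ (∀ y : Y', (IsDomain (Y'.presheaf.stalk y) ∧ ∀ d : ℕ, ringKrullDim (Y'.presheaf.stalk y) = d → ∀ s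
    : Fin d → (Y'.presheaf.stalk y), (Ideal.span (Set.range s)).radical.IsMaximal →
    RingTheory.Sequence.IsWeaklyRegular (Y'.presheaf.stalk y) (List.ofFn s) ∧ ∀ u : (Y'.presheaf.stalk y),
    (∃ e : ℕ, u ^ p ^ e ∈ Ideal.span ((fun z : (Y'.presheaf.stalk y) => z ^ p ^ e) '' (Ideal.span (Set.range
    s) : Set (Y'.presheaf.stalk y)))) → u ∈ Ideal.span (Set.range s))) ∧ {x : Y' | ¬ (IsDomain
    (Y'.presheaf.stalk x) ∧ ∀ d : ℕ, ringKrullDim (Y'.presheaf.stalk x) = d → ∀ s : Fin d →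
    (Y'.presheaf.stalk x), (Ideal.span (Set.range s)).radical.IsMaximal → ∀ u c : (Y'.presheaf.stalk x), c ≠
    0 → (∀ e : ℕ, c * u ^ p ^ e ∈ Ideal.span ((fun z : (Y'.presheaf.stalk x) => z ^ p ^ e) '' (Ideal.span
    (Set.range s) : Set (Y'.presheaf.stalk x)))) → u ∈ Ideal.span (Set.range s))}.Finite ∧ (∀ x : Y', ¬
    (IsDomain (Y'.presheaf.stalk x) ∧ ∀ d : ℕ, ringKrullDim (Y'.presheaf.stalk x) = d → ∀ s : Fin d →
    (Y'.presheaf.stalk x), (Ideal.span (Set.range s)).radical.IsMaximal → ∀ u c : (Y'.presheaf.stalk x), c ≠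
    0 → (∀ e : ℕ, c * u ^ p ^ e ∈ Ideal.span ((fun z : (Y'.presheaf.stalk x) => z ^ p ^ e) '' (Ideal.span
    (Set.range s) : Set (Y'.presheaf.stalk x)))) → u ∈ Ideal.span (Set.range s)) → ∀ y : Y', y ⤳ x → y ≠ x →
    IsRegularLocalRing (Y'.presheaf.stalk y)) := by
  have hp : p.Prime := Fact.out
  -- `Y` is its own rung-2 model along the identity
  have hid : IsBirational (𝟙 Y) := ⟨⊤, by simp [dense_univ], by simp [dense_univ], inferInstance⟩
  have hante : ∃ (X' : Scheme.{0}) (π : X' ⟶ Y), IsProper π ∧ IsBirational π ∧ ∀ x : X', IsDomain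
      (X'.presheaf.stalk x) ∧ ∀ d : ℕ, ringKrullDim (X'.presheaf.stalk x) = d → ∀ s : Fin d →
      X'.presheaf.stalk x, (Ideal.span (Set.range s)).radical.IsMaximal →
      RingTheory.Sequence.IsWeaklyRegular (X'.presheaf.stalk x) (List.ofFn s) ∧ ∀ y : X'.presheaf.stalk x,
      (∃ e : ℕ, y ^ p ^ e ∈ Ideal.span ((fun z : X'.presheaf.stalk x => z ^ p ^ e) '' (Ideal.span
      (Set.range s) : Set (X'.presheaf.stalk x)))) → y ∈ Ideal.span (Set.range s) :=
    ⟨Y, 𝟙 Y, inferInstance, hid, h₂⟩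
  -- the crux hands back an F-rational (rung-3) model, which isolates the defect
  obtain ⟨Y', ρ, hρp, hρb, h₃⟩ := hcrux p hp k Y g inferInstance inferInstance inferInstance inferInstance hante
  haveI := hρp
  exact ⟨Y', ρ, isolateDefect_of_rungThreeModel p k Y g ρ hρb h₃⟩

end Summit.ResolutionOfSingularities.ResolutionOfSingularities.Theorems.FRationalModification.IsolateDefectOfCrux

end
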